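import Summits.NavierStokesRegularity.NavierStokesRegularity.Theorems.SoloSalvageWu2026PressureCompactScaling
import Summits.NavierStokesRegularity.NavierStokesRegularity.Theorems.SoloSalvageWu2026ConstructProfile
import Literature.Analysis.FluidPDE.NormalisedPressureSmooth
import Literature.Analysis.FluidPDE.WeylLemmaBall
import HarnessLib

/-!
# C177 `Wu2026` — toward `Step_construct` (B), pressure compactness (3.45): the local split
# `P_j = L_j + H_j`, `L_j = p̃[χV_j]`, `H_j` harmonic where `χ = 1`, with scale-free bounds and
# uniformly bounded, uniformly Lipschitz Weyl representatives of the harmonic parts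

Seat `ns-in-wu-341` on sub-binder (B) of `step_construct_of_pieces` (cut owner `ns-inputs-plan` g5
ruling 07:43Z; holder of `Step_construct` = `ns-in-wu-con`). Salvage conventions: theorems only,
standard axioms, no definition, no named fact; `--supports` item 0897.

Print (arXiv:2608.22471v1, p.15 l.17–33): «Local compactness. The pressure is nonlocal. We isolate
a local Riesz-transform part, which converges strongly, and treat the complementary part as
harmonic. Choose bounded open sets K ⋐ U ⋐ U′ ⋐ R³∖{0} and a cutoff χ ∈ C_c^∞(U′) equal to one in a
neighborhood of U. Set L_j := R_iR_k(χV_{j,i}V_{j,k}), H_j := P_j − L_j. By (3.39), ΔH_j = 0 in U …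
The global weak bound (3.43), the finite-measure embedding on U, and the preceding bound for L_j
imply sup_j ‖H_j‖ ≤ C_U. The interior estimates for harmonic functions yield …».

For an `IsWuFlow` with `v ∈ L^{9/2,∞}`, the constant `c` of `Step_construct` (`p − c ∈ L^{9/4,∞}`),
a scale `R > 0` (`V_R = blowDown R v`, `P_R = blowDownP R (p − c)`) and a cutoff `χ ∈ C_c^∞`,
`|χ| ≤ 1`:
* `integral_harmonicPart_mul_laplacian_eq_zero` — `H_R = P_R − p̃[χV_R]` is weakly harmonic on
  every open set on which `χ = 1` ((3.39) `P_R = p̃[V_R]` a.e. and the weak pressure Poisson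
  equations of `p̃[V_R]`, `p̃[χV_R]`, whose sources agree where `χ = 1`);
* `exists_forall_setLIntegral_harmonicPart_le` — `sup_R ∫_B |H_R| < ∞` on every set `B` of finite
  measure (weak-`L^{9/4}` bound (3.43) of `P_R` + Stein's `L²` bound of `p̃[χV_R]` by the
  scale-free `L⁴` bound of `V_R` on `tsupport χ`);
* `exists_forall_harmonicPart_rep` — if `χ = 1` on `B(c₀, 2r)`: Weyl representatives `H'_R`,
  `H_R = H'_R` a.e. on `B(c₀, r)`, with `|H'_R| ≤ B`, `|H'_R(y) − H'_R(z)| ≤ B|y − z|`, `B`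
  INDEPENDENT of `R` (the tree's Weyl lemma with interior estimates
  `exists_lipschitz_rep_of_weaklyHarmonic`) — the equicontinuity behind «Arzelà–Ascoli».

WHAT THIS IS NOT: not a proof of `Step_construct`; not a claim about NS regularity or blow-up; not
a claim about any author beyond the typed locator.
-/

noncomputable section

set_option linter.dupNamespace false

open MeasureTheory Set Function Filter Topology Metric
open scoped ENNReal NNReal RealInnerProductSpace Laplacian ContDiff

namespace Summit.NavierStokesRegularity.NavierStokesRegularity.Theorems.Wu2026Salvage

open Literature.Claims.NS.Wu2026 Literature.Analysis.FluidPDE Literature.Analysis.FunctionSpaces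

-- nested operator types in the imported pressure files
set_option maxSynthPendingDepth 3

variable {ν : ℝ} {v : E3 → E3} {p : E3 → ℝ}

/-! ### Regularity of the blow-down and of the local Riesz part -/

/-- The localised blow-down `χV_R` (`χ ∈ C_c^∞`, `v ∈ C^∞`) is a test field. [folklore] -/
theorem contDiff_cutoff_smul_blowDown (hv : ContDiff ℝ ∞ v) {χ : E3 → ℝ} (hχ : ContDiff ℝ ∞ χ)
    (R : ℝ) : ContDiff ℝ ∞ (fun y => χ y • blowDown R v y) :=
  hχ.smul (contDiff_blowDown hv R)

/-- The local Riesz part `L_R = p̃[χV_R]` is smooth (`p̃` of a test field,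
`contDiff_normalisedPressure_of_contDiff_infty`). [cite: Wu2026, p.15 l.21 (L_j)] -/
theorem contDiff_localRiesz (hv : ContDiff ℝ ∞ v) {χ : E3 → ℝ} (hχ : ContDiff ℝ ∞ χ)
    (hχc : HasCompactSupport χ) (R : ℝ) :
    ContDiff ℝ ∞ (normalisedPressure (fun y => χ y • blowDown R v y)) :=
  contDiff_normalisedPressure_of_contDiff_infty (contDiff_cutoff_smul_blowDown hv hχ R)
    hχc.smul_right

/-- The harmonic part `H_R = P_R − L_R` is continuous. [cite: Wu2026, p.15 l.21 (H_j)] -/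
theorem continuous_harmonicPart (hf : IsWuFlow ν v p) (c : ℝ) {χ : E3 → ℝ} (hχ : ContDiff ℝ ∞ χ)
    (hχc : HasCompactSupport χ) (R : ℝ) :
    Continuous fun y => blowDownP R (fun x => p x - c) y -
      normalisedPressure (fun y => χ y • blowDown R v y) y :=
  (continuous_blowDownP (hf.smooth_p.continuous.sub continuous_const) R).sub
    (contDiff_localRiesz hf.smooth_v hχ hχc R).continuous

/-! ### Weak harmonicity of `H_R` where `χ = 1` -/

/-- **`ΔH_j = 0` in `U`** (p.15 l.22–25): for every open... indeed every set `U` on which `χ = 1`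
and every test function supported in `U`, `∫ H_R Δφ = 0` — from (3.39) `P_R = p̃[V_R]` a.e. and the
weak pressure Poisson equations `∫ p̃[w] Δφ = −∫ D²φ(w, w)` for `w = V_R` and `w = χV_R`, whose
right-hand sides agree since `χ = 1` on `tsupport φ`. [cite: Wu2026, p.15 l.22–25] -/
theorem integral_harmonicPart_mul_laplacian_eq_zero (hf : IsWuFlow ν v p)
    (hvw : MemWeakLp v ((9 : ℝ≥0∞) / 2) volume) {c : ℝ}
    (hpc : MemWeakLp (fun x => p x - c) ((9 : ℝ≥0∞) / 4) volume) {R : ℝ} (hR : 0 < R)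
    {χ : E3 → ℝ} (hχ : ContDiff ℝ ∞ χ) (hχc : HasCompactSupport χ) {U : Set E3}
    (hχ1 : ∀ y ∈ U, χ y = 1) {φ : E3 → ℝ} (hφ : ContDiff ℝ ∞ φ) (hφc : HasCompactSupport φ)
    (hφU : tsupport φ ⊆ U) :
    ∫ y, (blowDownP R (fun x => p x - c) y -
      normalisedPressure (fun y => χ y • blowDown R v y) y) * (Δ φ) y = 0 := by
  have h3_1 : (1 : ℝ≥0∞) < 3 := by norm_num
  have h3_t : (3 : ℝ≥0∞) < ⊤ := ENNReal.ofNat_lt_top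
  set V : E3 → E3 := blowDown R v with hV
  set P : E3 → ℝ := blowDownP R (fun x => p x - c) with hP
  set W : E3 → E3 := fun y => χ y • V y with hW
  have hVc : Continuous V := continuous_blowDown hf.smooth_v.continuous R
  have hPc : Continuous P := continuous_blowDownP (hf.smooth_p.continuous.sub continuous_const) R
  have hLc : Continuous (normalisedPressure W) := (contDiff_localRiesz hf.smooth_v hχ hχc R).continuous
  have hV6 : MemLp V (2 * 3) volume := memLp_two_mul_three_blowDown hf hvw hR
  have hW6 : MemLp W (2 * 3) volume :=
    (hχ.continuous.smul hVc).memLp_of_hasCompactSupport hχc.smul_right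
  have hPae : P =ᵐ[volume] normalisedPressure V :=
    blowDownP_ae_eq_normalisedPressure_blowDown hf hvw hpc hR
  -- `Δφ` is continuous with compact support
  have hΔc : Continuous (Δ φ) := Literature.Analysis.FluidPDE.continuous_laplacian (contDiff_infty.1 hφ 2)
  have hΔs : HasCompactSupport (Δ φ) :=
    hφc.mono' fun x hx => by
      contrapose! hx
      simp [Literature.Analysis.FluidPDE.laplacian_eq_zero_of_notMem_tsupport hx]
  have iP : Integrable fun y => P y * (Δ φ) y :=
    (hPc.mul hΔc).integrable_of_hasCompactSupport hΔs.mul_left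
  have iL : Integrable fun y => normalisedPressure W y * (Δ φ) y :=
    (hLc.mul hΔc).integrable_of_hasCompactSupport hΔs.mul_left
  -- the two Poisson equations
  have hPoisV : ∫ y, normalisedPressure V y * (Δ φ) y = -∫ y, fderiv ℝ (fderiv ℝ φ) y (V y) (V y) :=
    integral_normalisedPressure_mul_laplacian_of_memLp h3_1 h3_t hV6 hφ hφc
  have hPoisW : ∫ y, normalisedPressure W y * (Δ φ) y = -∫ y, fderiv ℝ (fderiv ℝ φ) y (W y) (W y) :=
    integral_normalisedPressure_mul_laplacian_of_memLp h3_1 h3_t hW6 hφ hφc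
  -- the sources agree: `D²φ(χV, χV) = D²φ(V, V)` pointwise
  have hsrc : (fun y => fderiv ℝ (fderiv ℝ φ) y (W y) (W y)) =
      fun y => fderiv ℝ (fderiv ℝ φ) y (V y) (V y) := by
    funext y
    by_cases hy : y ∈ tsupport φ
    · simp only [hW, hχ1 y (hφU hy), one_smul]
    · have hy' : y ∉ tsupport (fderiv ℝ φ) := fun h => hy (tsupport_fderiv_subset ℝ h)
      rw [fderiv_of_notMem_tsupport ℝ hy']
      simp
  have hPint : ∫ y, P y * (Δ φ) y = ∫ y, normalisedPressure V y * (Δ φ) y :=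
    integral_congr_ae (hPae.mono fun y hy => by simp only [hy])
  simp_rw [sub_mul]
  rw [integral_sub iP iL, hPint, hPoisV, hPoisW, hsrc, sub_self]

/-! ### The scale-free `L¹` bound of the harmonic part -/

/-- **`sup_j ∫_B |H_j| < ∞`** (p.15 l.28–31): for a set `B` of finite measure there is `C` (finite,
independent of `R`) with `∫_B |H_R| ≤ C` for all `R > 0`, where `H_R = P_R − p̃[χV_R]`: the
weak-`L^{9/4}` bound (3.43) of `P_R` gives `∫_B|P_R| ≤ |B| + (4/5)‖p − c‖^{9/4}_{9/4,∞}`; Stein's `L²`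
bound and `‖χV_R‖₄⁴ ≤ ∫_{tsupport χ}|V_R|⁴ ≤ |tsupport χ| + 8‖v‖^{9/2}_{9/2,∞}` give the `L¹(B)` bound
of the local Riesz part by Cauchy–Schwarz. [cite: Wu2026, (3.43) p.15 l.8–12, p.15 l.28–31] -/
theorem exists_forall_setLIntegral_harmonicPart_le (hf : IsWuFlow ν v p)
    (hvw : MemWeakLp v ((9 : ℝ≥0∞) / 2) volume) {c : ℝ}
    (hpc : MemWeakLp (fun x => p x - c) ((9 : ℝ≥0∞) / 4) volume)
    {χ : E3 → ℝ} (hχ : ContDiff ℝ ∞ χ) (hχc : HasCompactSupport χ) (hχ01 : ∀ y, |χ y| ≤ 1)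
    {B : Set E3} (hB : volume B < ⊤) :
    ∃ C : ℝ≥0∞, C < ⊤ ∧ ∀ R : ℝ, 0 < R →
      ∫⁻ y in B, ‖blowDownP R (fun x => p x - c) y -
        normalisedPressure (fun y => χ y • blowDown R v y) y‖ₑ ≤ C := by
  have h2_1 : (1 : ℝ≥0∞) < 2 := by norm_num
  have h2_t : (2 : ℝ≥0∞) < ⊤ := ENNReal.ofNat_lt_top
  have h22_0 : (2 * 2 : ℝ≥0∞) ≠ 0 := by norm_num
  have h22_t : (2 * 2 : ℝ≥0∞) ≠ ⊤ := by norm_num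
  have h22_r : (2 * 2 : ℝ≥0∞).toReal = 4 := by norm_num
  obtain ⟨C₂, hC₂⟩ := exists_eLpNorm_normalisedPressure_le_sq (p := (2 : ℝ≥0∞)) h2_1 h2_t
  set Wv : ℝ≥0∞ := eWeakLpPow v ((9 : ℝ≥0∞) / 2) volume with hWv
  set WP : ℝ≥0∞ := eWeakLpPow (fun x => p x - c) ((9 : ℝ≥0∞) / 4) volume with hWP
  set S : Set E3 := tsupport χ with hS
  have hSfin : volume S < ⊤ := hχc.isCompact.measure_lt_top
  -- the scale-free `L⁴` budget of `χ V_R`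
  set A : ℝ≥0∞ := volume S + ENNReal.ofReal 8 * Wv with hA
  have hAt : A < ⊤ := ENNReal.add_lt_top.2 ⟨hSfin, ENNReal.mul_lt_top ENNReal.ofReal_lt_top hvw.2⟩
  set C : ℝ≥0∞ := volume B + ENNReal.ofReal (4 / 5) * WP +
    (C₂ : ℝ≥0∞) * (A ^ (1 / (4 : ℝ))) ^ 2 * volume B ^ (1 / (2 : ℝ)) with hC_def
  have hCt : C < ⊤ := by
    have h1 : ENNReal.ofReal (4 / 5) * WP < ⊤ := ENNReal.mul_lt_top ENNReal.ofReal_lt_top hpc.2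
    have h2 : (A ^ (1 / (4 : ℝ))) ^ 2 < ⊤ :=
      ENNReal.pow_lt_top (ENNReal.rpow_lt_top_of_nonneg (by norm_num) hAt.ne)
    have h3 : volume B ^ (1 / (2 : ℝ)) < ⊤ := ENNReal.rpow_lt_top_of_nonneg (by norm_num) hB.ne
    exact ENNReal.add_lt_top.2 ⟨ENNReal.add_lt_top.2 ⟨hB, h1⟩,
      ENNReal.mul_lt_top (ENNReal.mul_lt_top ENNReal.coe_lt_top h2) h3⟩
  refine ⟨C, hCt, fun R hR => ?_⟩
  set V : E3 → E3 := blowDown R v with hV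
  set P : E3 → ℝ := blowDownP R (fun x => p x - c) with hP
  set W : E3 → E3 := fun y => χ y • V y with hW
  have hVc : Continuous V := continuous_blowDown hf.smooth_v.continuous R
  have hPc : Continuous P := continuous_blowDownP (hf.smooth_p.continuous.sub continuous_const) R
  have hWc : Continuous W := hχ.continuous.smul hVc
  have hLc : Continuous (normalisedPressure W) :=
    (contDiff_localRiesz hf.smooth_v hχ hχc R).continuous
  -- (i) the weak-`L^{9/4}` part
  have hP1 : ∫⁻ y in B, ‖P y‖ₑ ≤ volume B + ENNReal.ofReal (4 / 5) * WP :=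
    setLIntegral_enorm_le_of_eWeakLpPow_le hPc.aestronglyMeasurable B
      (eWeakLpPow_blowDownP_le (fun x => p x - c) hR)
  -- (ii) `‖χV_R‖₄ ≤ A^{1/4}`
  have hW4 : eLpNorm W (2 * 2) volume ≤ A ^ (1 / (4 : ℝ)) := by
    rw [eLpNorm_eq_lintegral_rpow_enorm_toReal h22_0 h22_t, h22_r]
    refine ENNReal.rpow_le_rpow ?_ (by norm_num)
    have hle : ∀ y, ‖W y‖ₑ ^ (4 : ℝ) ≤ S.indicator (fun y => ‖V y‖ₑ ^ (4 : ℝ)) y := by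
      intro y
      by_cases hy : y ∈ S
      · rw [indicator_of_mem hy]
        refine ENNReal.rpow_le_rpow ?_ (by norm_num)
        rw [hW]
        simp only [enorm_smul]
        calc ‖χ y‖ₑ * ‖V y‖ₑ ≤ 1 * ‖V y‖ₑ := by
              refine mul_le_mul' ?_ le_rfl
              rw [← ofReal_norm, Real.norm_eq_abs, ← ENNReal.ofReal_one]
              exact ENNReal.ofReal_le_ofReal (hχ01 y)
          _ = ‖V y‖ₑ := one_mul _
      · rw [indicator_of_notMem hy, hW]
        simp [image_eq_zero_of_notMem_tsupport hy]
    calc ∫⁻ y, ‖W y‖ₑ ^ (4 : ℝ) ≤ ∫⁻ y, S.indicator (fun y => ‖V y‖ₑ ^ (4 : ℝ)) y :=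
          lintegral_mono hle
      _ = ∫⁻ y in S, ‖V y‖ₑ ^ (4 : ℝ) := lintegral_indicator (isClosed_tsupport χ).measurableSet _
      _ ≤ A := setLIntegral_rpow_four_le_of_eWeakLpPow_le hVc.aestronglyMeasurable S
          (eWeakLpPow_blowDown_le v hR)
  -- (iii) Stein and Cauchy–Schwarz on `B`
  have hWmem : MemLp W (2 * 2) volume := hWc.memLp_of_hasCompactSupport hχc.smul_right
  have hL2 : eLpNorm (normalisedPressure W) 2 volume ≤ (C₂ : ℝ≥0∞) * (A ^ (1 / (4 : ℝ))) ^ 2 :=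
    (hC₂ W hWmem).trans (mul_le_mul' le_rfl (pow_le_pow_left' hW4 2))
  have hL1 : ∫⁻ y in B, ‖normalisedPressure W y‖ₑ ≤
      (C₂ : ℝ≥0∞) * (A ^ (1 / (4 : ℝ))) ^ 2 * volume B ^ (1 / (2 : ℝ)) := by
    have h := eLpNorm_le_eLpNorm_mul_rpow_measure_univ (μ := volume.restrict B) (p := 1) (q := 2)
      (by norm_num) hLc.aestronglyMeasurable.restrict
    rw [eLpNorm_one_eq_lintegral_enorm, Measure.restrict_apply_univ] at h
    simp only [ENNReal.toReal_one, ENNReal.toReal_ofNat, div_one] at h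
    refine h.trans ?_
    have hmono : eLpNorm (normalisedPressure W) 2 (volume.restrict B) ≤
        eLpNorm (normalisedPressure W) 2 volume := eLpNorm_mono_measure _ Measure.restrict_le_self
    calc eLpNorm (normalisedPressure W) 2 (volume.restrict B) * volume B ^ (1 - 1 / (2 : ℝ))
        ≤ (C₂ : ℝ≥0∞) * (A ^ (1 / (4 : ℝ))) ^ 2 * volume B ^ (1 - 1 / (2 : ℝ)) :=
          mul_le_mul' (hmono.trans hL2) le_rfl
      _ = (C₂ : ℝ≥0∞) * (A ^ (1 / (4 : ℝ))) ^ 2 * volume B ^ (1 / (2 : ℝ)) := by norm_num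
  -- (iv) assemble
  calc ∫⁻ y in B, ‖P y - normalisedPressure W y‖ₑ
      ≤ ∫⁻ y in B, (‖P y‖ₑ + ‖normalisedPressure W y‖ₑ) :=
        lintegral_mono fun y => enorm_sub_le
    _ = (∫⁻ y in B, ‖P y‖ₑ) + ∫⁻ y in B, ‖normalisedPressure W y‖ₑ :=
        lintegral_add_left' hPc.aestronglyMeasurable.enorm.restrict _
    _ ≤ volume B + ENNReal.ofReal (4 / 5) * WP +
          (C₂ : ℝ≥0∞) * (A ^ (1 / (4 : ℝ))) ^ 2 * volume B ^ (1 / (2 : ℝ)) := add_le_add hP1 hL1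

/-! ### Weyl representatives with scale-free bounds -/

/-- **Uniformly bounded, uniformly Lipschitz representatives of the harmonic parts** («The interior
estimates for harmonic functions yield ‖H_j‖_{C^{m+1}(K)} ≤ C», p.16 l.1–2, in the form the tree's
Weyl lemma `exists_lipschitz_rep_of_weaklyHarmonic` gives): if `χ ∈ C_c^∞`, `|χ| ≤ 1`, `χ = 1` on
`B(c₀, 2r)`, there is `B ≥ 0` such that for every `R > 0` the harmonic part `H_R = P_R − p̃[χV_R]`
agrees a.e. on `B(c₀, r)` with an `H'_R` satisfying `|H'_R| ≤ B` and `|H'_R(y) − H'_R(z)| ≤ B|y − z|`.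
[cite: Wu2026, p.15 l.33 – p.16 l.4; GilbargTrudinger2001, Thm 2.10] -/
theorem exists_forall_harmonicPart_rep (hf : IsWuFlow ν v p)
    (hvw : MemWeakLp v ((9 : ℝ≥0∞) / 2) volume) {c : ℝ}
    (hpc : MemWeakLp (fun x => p x - c) ((9 : ℝ≥0∞) / 4) volume)
    {χ : E3 → ℝ} (hχ : ContDiff ℝ ∞ χ) (hχc : HasCompactSupport χ) (hχ01 : ∀ y, |χ y| ≤ 1)
    (c₀ : E3) {r : ℝ} (hr : 0 < r) (hχ1 : ∀ y ∈ ball c₀ (2 * r), χ y = 1) :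
    ∃ B : ℝ, 0 ≤ B ∧ ∀ R : ℝ, 0 < R → ∃ H' : E3 → ℝ,
      (∀ y, |H' y| ≤ B) ∧ (∀ y z, |H' y - H' z| ≤ B * ‖y - z‖) ∧
      (fun y => blowDownP R (fun x => p x - c) y -
        normalisedPressure (fun y => χ y • blowDown R v y) y) =ᵐ[volume.restrict (ball c₀ r)] H' := by
  obtain ⟨K, hK0, hK⟩ := WeylLemmaBall.exists_lipschitz_rep_of_weaklyHarmonic (r₁ := r) hr
  obtain ⟨C, hCt, hC⟩ := exists_forall_setLIntegral_harmonicPart_le hf hvw hpc hχ hχc hχ01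
    (B := ball c₀ (2 * r)) measure_ball_lt_top
  refine ⟨K * C.toReal, mul_nonneg hK0 ENNReal.toReal_nonneg, fun R hR => ?_⟩
  set H : E3 → ℝ := fun y => blowDownP R (fun x => p x - c) y -
    normalisedPressure (fun y => χ y • blowDown R v y) y with hH
  have hHc : Continuous H := continuous_harmonicPart hf c hχ hχc R
  -- integrability on the ball and the real `L¹` bound
  have hHint : IntegrableOn H (ball c₀ (2 * r)) volume :=
    (hHc.continuousOn.integrableOn_compact (isCompact_closedBall c₀ (2 * r))).mono_set
      ball_subset_closedBall
  have hI : ∫ y in ball c₀ (2 * r), |H y| ≤ C.toReal := by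
    have h1 : ∫ y in ball c₀ (2 * r), |H y| = (∫⁻ y in ball c₀ (2 * r), ‖H y‖ₑ).toReal := by
      rw [← integral_norm_eq_lintegral_enorm hHint.aestronglyMeasurable]
      simp only [Real.norm_eq_abs]
    rw [h1]
    exact ENNReal.toReal_mono hCt.ne (hC R hR)
  -- weak harmonicity on the ball, in the set-integral form of the Weyl lemma
  have hharm : ∀ φ : E3 → ℝ,
      IsTestFunctionOn (⟨ball c₀ (2 * r), isOpen_ball⟩ : TopologicalSpace.Opens E3) φ →
        ∫ y in ball c₀ (2 * r), H y * (Δ φ) y = 0 := by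
    intro φ hφ
    rw [setIntegral_eq_integral_of_forall_compl_eq_zero]
    · exact integral_harmonicPart_mul_laplacian_eq_zero hf hvw hpc hR hχ hχc hχ1 hφ.contDiff
        hφ.hasCompactSupport hφ.tsupport_subset
    · intro y hy
      have hy' : y ∉ tsupport φ := fun h => hy (hφ.tsupport_subset h)
      rw [Literature.Analysis.FluidPDE.laplacian_eq_zero_of_notMem_tsupport hy', mul_zero]
  obtain ⟨H', hae, hbd, hlip⟩ := hK c₀ (2 * r) H hHint hharm
  have hrr : 2 * r - r = r := by ring
  rw [hrr] at hae
  refine ⟨H', fun y => (hbd y).trans ?_, fun y z => (hlip y z).trans ?_, hae⟩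
  · exact mul_le_mul_of_nonneg_left hI hK0
  · exact mul_le_mul_of_nonneg_right (mul_le_mul_of_nonneg_left hI hK0) (norm_nonneg _)

end Summit.NavierStokesRegularity.NavierStokesRegularity.Theorems.Wu2026Salvage

end

-- WHAT THIS IS NOT: not a claim about NS regularity or blow-up; not a claim about any author beyond the typed locator.
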